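import Literature.Topology.FourManifolds.ComplexProjectiveSpaceProofs
import Mathlib.Geometry.Manifold.MFDeriv.Atlas
import Mathlib.Geometry.Manifold.MFDeriv.SpecificFunctions
import Mathlib.Geometry.Manifold.MFDeriv.Tangent

/-!
# The differential of a two-chart sphere glued into `ℂℙ¹ → M`
(helper `helper_gluedSphereMfderiv` of line `cross-cap-laurent`, crux `GromovRecognitionRelEnd`,
item stmt-SmoothPoincare4-11009; a piece of `helper_noJSpheres`)

A pair of planes `u v : ℂ → M` (in the application `v z = u z⁻¹`) is glued into a map
`F : ℂℙ¹ → M` out of the tree's complex projective line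
`Literature.Topology.FourManifolds.ComplexProjectiveSpace 1` (charted on
`EuclideanSpace ℝ (Fin (2 * 1))` by its two affine charts) through the two clauses
`F p = u (affineCoordComplex 0 p 0)` on `{CoordNeZero 0}` and
`F p = v (affineCoordComplex 1 p 0)` on `{CoordNeZero 1}`. This file computes the differential
of `F` at `p` read in the preferred chart `chartAt p = affineChart (chartIndex p)`: if
`chartIndex p = 0` then `dF_p a = du_{c₀ p} (ℓ a)` with `c₀ p = affineCoordComplex 0 p 0` and
`ℓ a = ((realCoordinates 1).symm a) 0`, and symmetrically for index `1` with `v`.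

Proof: on the open chart domain `{CoordNeZero i}` (`i = chartIndex p`) one has
`F = w ∘ ℓ ∘ extChartAt p` (`w = u` or `v`), since
`extChartAt p = affineChart i = realCoordinates 1 ∘ affineCoordComplex i`; the chain rule
(`HasMFDerivAt.comp`) with `hasMFDerivAt_extChartAt`, `ContinuousLinearMap.hasMFDerivAt` and the
differentiability of the `C^∞` map `w`, then `HasMFDerivAt.congr_of_eventuallyEq` and
`mfderiv (chartAt p) p = id` (`mfderiv_chartAt_eq_tangentCoordChange`, `tangentCoordChange_self`).

References: standard differential calculus on manifolds (folklore); P. Griffiths, J. Harris,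
*Principles of Algebraic Geometry* (1978), Ch. 0 §2 for the affine charts of `ℂℙⁿ`.
No new definitions, notation or instances.
-/

noncomputable section

-- the prescribed namespace `Summit.<P>.<Sub>.…` duplicates `SmoothPoincare4` (P = Sub)
set_option linter.dupNamespace false

open scoped Manifold ContDiff Topology
open Set Function
open Literature.Topology.FourManifolds Literature.Topology.FourManifolds.ComplexProjectiveSpace

namespace Summit.SmoothPoincare4.SmoothPoincare4.Theorems.GromovRecognitionRelEnd.CrossCapLaurent

/-- **Differential of a map factoring through the preferred affine coordinate.** If
`F : ℂℙ¹ → M` agrees with `w ∘ (affineCoordComplex i · 0)` on the domain `{CoordNeZero i}`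
of the preferred chart `i = chartIndex p` of `p`, with `w : ℂ → M` of class `C^∞`, then
`dF_p a = dw_{affineCoordComplex i p 0} (((realCoordinates 1).symm a) 0)` for every model vector
`a` (chain rule in the chart `affineChart i = realCoordinates 1 ∘ affineCoordComplex i`).
[folklore] -/
theorem mfderiv_of_eq_comp_affineCoordComplex_chartIndex {M : Type} [TopologicalSpace M]
    [ChartedSpace (EuclideanSpace ℝ (Fin 4)) M] [IsManifold (𝓡 4) ∞ M] {w : ℂ → M}
    (hw : ContMDiff 𝓘(ℝ, ℂ) (𝓡 4) ∞ w) {F : ComplexProjectiveSpace 1 → M}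
    (p : ComplexProjectiveSpace 1)
    (hF : ∀ q, CoordNeZero (chartIndex p) q → F q = w (affineCoordComplex (chartIndex p) q 0))
    (a : EuclideanSpace ℝ (Fin (2 * 1))) :
    mfderiv (𝓡 (2 * 1)) (𝓡 4) F p a =
      mfderiv 𝓘(ℝ, ℂ) (𝓡 4) w (affineCoordComplex (chartIndex p) p 0)
        (((realCoordinates 1).symm a) 0) := by
  -- the complex affine coordinate read on the model plane, as a continuous linear map
  set ℓ : EuclideanSpace ℝ (Fin (2 * 1)) →L[ℝ] ℂ :=
    (ContinuousLinearMap.proj (R := ℝ) (φ := fun _ : Fin 1 => ℂ) 0).comp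
      ((realCoordinates 1).symm : EuclideanSpace ℝ (Fin (2 * 1)) →L[ℝ] (Fin 1 → ℂ))
  have hℓa : ∀ b : EuclideanSpace ℝ (Fin (2 * 1)), ℓ b = ((realCoordinates 1).symm b) 0 :=
    fun b => rfl
  have hp : p ∈ (chartAt (EuclideanSpace ℝ (Fin (2 * 1))) p).source := mem_chart_source _ p
  -- the extended preferred chart followed by `ℓ` is the complex affine coordinate
  have hc : ∀ q,
      (ℓ ∘ extChartAt (𝓡 (2 * 1)) p) q = affineCoordComplex (chartIndex p) q 0 := by
    intro q
    simp only [comp_apply, extChartAt_coe, modelWithCornersSelf_coe, id, hℓa]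
    rw [chartAt_eq, affineChart_apply, affineCoord, comp_apply,
      ContinuousLinearEquiv.symm_apply_apply]
  -- chain rule
  have h1 : HasMFDerivAt (𝓡 (2 * 1)) 𝓘(ℝ, EuclideanSpace ℝ (Fin (2 * 1)))
      (extChartAt (𝓡 (2 * 1)) p) p
      (mfderiv (𝓡 (2 * 1)) (𝓡 (2 * 1)) (chartAt (EuclideanSpace ℝ (Fin (2 * 1))) p) p) :=
    hasMFDerivAt_extChartAt hp
  have h2 : HasMFDerivAt 𝓘(ℝ, EuclideanSpace ℝ (Fin (2 * 1))) 𝓘(ℝ, ℂ) ℓ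
      (extChartAt (𝓡 (2 * 1)) p p) ℓ :=
    ℓ.hasMFDerivAt
  have h3 : HasMFDerivAt (𝓡 (2 * 1)) 𝓘(ℝ, ℂ) (ℓ ∘ extChartAt (𝓡 (2 * 1)) p) p
      (ℓ.comp (mfderiv (𝓡 (2 * 1)) (𝓡 (2 * 1))
        (chartAt (EuclideanSpace ℝ (Fin (2 * 1))) p) p)) :=
    h2.comp p h1
  have h4 : HasMFDerivAt 𝓘(ℝ, ℂ) (𝓡 4) w ((ℓ ∘ extChartAt (𝓡 (2 * 1)) p) p)
      (mfderiv 𝓘(ℝ, ℂ) (𝓡 4) w (affineCoordComplex (chartIndex p) p 0)) := by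
    rw [hc]
    exact (hw.mdifferentiableAt (by simp)).hasMFDerivAt
  have h5 := h4.comp p h3
  -- `F` agrees with the composite near `p`
  have heq : F =ᶠ[𝓝 p] (w ∘ (ℓ ∘ extChartAt (𝓡 (2 * 1)) p)) := by
    filter_upwards [(isOpen_setOf_coordNeZero (chartIndex p)).mem_nhds
      (coordNeZero_chartIndex p)] with q hq
    rw [comp_apply, hc q]
    exact hF q hq
  -- the differential of the preferred chart, read in itself, is the identity
  have hid : mfderiv (𝓡 (2 * 1)) (𝓡 (2 * 1))
      (chartAt (EuclideanSpace ℝ (Fin (2 * 1))) p) p a = a := by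
    rw [mfderiv_chartAt_eq_tangentCoordChange hp]
    exact tangentCoordChange_self (I := 𝓡 (2 * 1)) (x := p) (z := p) (v := a)
      (mem_extChartAt_source p)
  rw [(h5.congr_of_eventuallyEq heq).mfderiv]
  exact congrArg (mfderiv 𝓘(ℝ, ℂ) (𝓡 4) w (affineCoordComplex (chartIndex p) p 0))
    (congrArg ℓ hid)

/-- **The differential of the glued sphere in the preferred chart** (registered stub
`helper_gluedSphereMfderiv` of line `cross-cap-laurent`, signature verbatim). For `C^∞` planes
`u v : ℂ → M` glued into `F : ℂℙ¹ → M` by `F = u ∘ (affineCoordComplex 0 · 0)` on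
`{CoordNeZero 0}` and `F = v ∘ (affineCoordComplex 1 · 0)` on `{CoordNeZero 1}`: at a point `p`
whose preferred chart is the affine chart `0`,
`dF_p a = du_{c₀ p} (((realCoordinates 1).symm a) 0)` with `c₀ p = affineCoordComplex 0 p 0`;
and with preferred chart `1`, `dF_p a = dv_{c₁ p} (((realCoordinates 1).symm a) 0)`,
`c₁ p = affineCoordComplex 1 p 0`. [folklore] -/
theorem helper_gluedSphereMfderiv : ∀ (M : Type) [TopologicalSpace M] [ChartedSpace (EuclideanSpace ℝ (Fin 4)) M] [IsManifold (𝓡 4) ∞ M] (u v : ℂ → M) (F : Literature.Topology.FourManifolds.ComplexProjectiveSpace 1 → M), ContMDiff 𝓘(ℝ, ℂ) (𝓡 4) ∞ u → ContMDiff 𝓘(ℝ, ℂ) (𝓡 4) ∞ v → (∀ p, Literature.Topology.FourManifolds.ComplexProjectiveSpace.CoordNeZero 0 p → F p = u (Literature.Topology.FourManifolds.ComplexProjectiveSpace.affineCoordComplex 0 p 0)) → (∀ p, Literature.Topology.FourManifolds.ComplexProjectiveSpace.CoordNeZero 1 p → F p = v (Literature.Topology.FourManifolds.ComplexProjectiveSpace.affineCoordComplex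 1 p 0)) → ∀ p : Literature.Topology.FourManifolds.ComplexProjectiveSpace 1, (Literature.Topology.FourManifolds.ComplexProjectiveSpace.chartIndex p = 0 → ∀ a : EuclideanSpace ℝ (Fin (2 * 1)), mfderiv (𝓡 (2 * 1)) (𝓡 4) F p a = mfderiv 𝓘(ℝ, ℂ) (𝓡 4) u (Literature.Topology.FourManifolds.ComplexProjectiveSpace.affineCoordComplex 0 p 0) (((Literature.Topology.FourManifolds.ComplexProjectiveSpace.realCoordinates 1).symm a) 0)) ∧ (Literature.Topology.FourManifolds.ComplexProjectiveSpace.chartIndex p = 1 → ∀ a : EuclideanSpace ℝ (Fin (2 * 1)), mfderiv (𝓡 (2 * 1)) (𝓡 4) F p a = mfderiv 𝓘(ℝ, ℂ) (𝓡 4) v (Literature.Topology.FourManifolds.ComplexProjectiveSpace.affineCoordComplex 1 p 0) (((Literature.Topology.FourManifolds.ComplexProjectiveSpace.realCoordinates 1).symm a) 0)) := by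
  intro M _ _ _ u v F hu hv hF0 hF1 p
  refine ⟨fun h0 a => ?_, fun h1 a => ?_⟩
  · have hF : ∀ q, CoordNeZero (chartIndex p) q →
        F q = u (affineCoordComplex (chartIndex p) q 0) := by
      rw [h0]; exact hF0
    have := mfderiv_of_eq_comp_affineCoordComplex_chartIndex hu p hF a
    rwa [h0] at this
  · have hF : ∀ q, CoordNeZero (chartIndex p) q →
        F q = v (affineCoordComplex (chartIndex p) q 0) := by
      rw [h1]; exact hF1
    have := mfderiv_of_eq_comp_affineCoordComplex_chartIndex hv p hF a
    rwa [h1] at this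

end Summit.SmoothPoincare4.SmoothPoincare4.Theorems.GromovRecognitionRelEnd.CrossCapLaurent
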